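import Mathlib
import HarnessLib
import Literature.MathematicalPhysics.QuantumFieldTheory.ConstructiveQFTWave0
import Summits.Ventures.LatticeQCDFlow.Scaling.TopologicalCollar
import Summits.Ventures.LatticeQCDFlow.Scaling.FluxSectorCollar
import Summits.Ventures.LatticeQCDFlow.Scaling.FluxPatch
import Summits.Ventures.LatticeQCDFlow.Scaling.FluxSmallSteps
import Summits.Ventures.LatticeQCDFlow.Scaling.MDTunnellingLaw

/-!
# LatticeQCDFlow / Scaling — TUNNELLING LAWS IV(b): the `U(1)` flux sector under molecular dynamics — the MOMENTUM COLLAR and the HMC law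

HONEST FRAMING: exact (Metropolis-corrected) sampling algorithms for lattice gauge theory;
figures of merit are autocorrelation/cost numbers at stated couplings and volumes; no
continuum-physics claim.

THEORY-2.md §3.3 / §5 (v4.3, theory seat GEN-24).  The lattice instance of the abstract MD / HMC
tunnelling law `Scaling/MDTunnellingLaw.lean` for compact `U(1)` configurations `U : Edge d L → Circle`
on `(ℤ/L)^d`, every `d`, every `L ≥ 1`, every plane `(μ,ν)` and base point `x₀` (flux charge
`topCharge x₀ μ ν` of `Scaling/FluxSectorCollar.lean`).
* §1 The MD DRIFT `drift δ ϖ U = (e ↦ exp(i δ ϖ_e) · U_e)` by Lie-algebra momenta `ϖ : Edge → ℝ` moves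
  the link `e` by the chord `|2 sin(δ ϖ_e / 2)| ≤ |δ|·|ϖ_e|`, hence the four links of the plaquette at `x`
  by at most `|δ|·Σ_{e ∈ ∂p} |ϖ_e|` (`plaqDisp_drift_le`) and — the group being ABELIAN — rotates the plaquette
  RIGIDLY by the angle `δ · curl ϖ (p)` (`plaquetteHolonomy_drift`, `plaqCurl` = the lattice curl of the
  momenta = the angular velocity of `U_p`); so along the MD segment a plaquette passes through the cut locus
  `-1` only if it started within the swept arc, whence (plane-local sector confinement of
  `Scaling/FluxSmallSteps.lean`, `topCharge_comp_eq_of_preconnected_plane`) a drift that changes the plane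
  charge starts in the MOMENTUM COLLAR `driftCollar x₀ μ ν δ ϖ = {U | ∃ p, ‖U_p + 1‖ ≤ |δ|·|curl ϖ (p)|}`
  (`mem_driftCollar_of_topCharge_ne`, DRIFT MARGIN `driftMargin = |δ|·|curl ϖ|`, sharp to first order):
  some plane plaquette is within ITS OWN swept arc of the cut locus — a per-plaquette, momentum-dependent
  collar replacing the sup-metric collar `4ρ` of `Scaling/FluxTunnelling.lean` (vacuous at production
  step sizes).
* §2 Trajectories: for phase-space steps whose configuration component is a drift by a momentum
  field read off the current phase point (`(step k z).1 = drift (δ k) (g k z) z.1`; momentum KICKS are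
  the case `g k = 0`, `drift_zero`), a change of the charge between node `0` and node `n` forces some
  node `k < n` into its momentum collar (`exists_mem_driftCollar_of_nodes_ne`) — leapfrog, any
  splitting order, multiple time scales, force-gradient variants whose position updates are drifts.
* §3 The collar events are measurable (`measurableSet_driftCollarAt`), and the **`U(1)` HMC FLUX
  TUNNELLING LAW** `hmc_topCharge_ne_le_sum`: for the HMC configuration kernel of
  `Exactness/MomentumRefresh.hmc_config_exact` (target `e^{-S}volU`, ANY measurable action `S` — Wilson
  at any `β`, improved, … —, momenta `π ∼ Z_T⁻¹e^{-T}volP` on any measurable space, proposal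
  `Φ = flip ∘ (n volume-preserving steps of the above form)`, Metropolis filter) and every `h : ℝ`:
  `(e^{-S}volU ⊗ K){Q ≠ Q'} ≤ Z_T⁻¹ Σ_{k<n} (e^{h}·B{z | z.1 ∈ driftCollar (δ k) (g k z)} + B{ΔH_k > h})`,
  `B = e^{-(S+T)}(volU ⊗ volP)`: per exact HMC update at stationarity, the plane charge changes at most
  as often as some interior node carries a plaquette within its drift margin of `-1` — priced at the
  Boltzmann weight up to the factor `e^{h}` — plus the probability that the energy violation at some
  node exceeds `h` (both standard monitors of an HMC run); and by Tonelli (`boltz_driftCollarAt_le_sum`)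
  the collar mass is at most `Σ_p E_{π ∼ e^{-T}}[(e^{-S}volU){U | ‖U_p + 1‖ ≤ |δ|·|curl π (p)|}]` — momentum-
  averaged single-plaquette cut-tails, `L²` of them per plane.
* The engine's kernel — `flip ∘ (leapfrog d g)^n` of `Exactness/SplittingIntegrator.lean`, proved exact
  there — as an instance (node schedule drift/kick/drift, `halfExp`) is `Scaling/MDLeapfrog.lean`
  (`u1_leapfrogHMC_topCharge_ne_le_sum` + `u1_leapfrogHMC_exact`: the SAME kernel is exact and obeys the law).
NOT here: the collar masses `B{…}` under the Wilson weight (THEORY-2.md §3.3: per node and plaquette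
`≍ |δ|·E|Σ|ϖ_e||·e^{-2β}√(β/2π)` in `d = 2`, a reading, not certified), the energy-violation tails
(measured inputs), the `SU(N)` ε-sector analogue.
-/

noncomputable section

namespace Summit.Ventures.LatticeQCDFlow.Theory2.Lattice.Flux

open MeasureTheory ProbabilityTheory Metric Set
open scoped ENNReal
open Literature.MathematicalPhysics.QuantumFieldTheory Literature.MathematicalPhysics.QuantumLattice
open Summit.Ventures.LatticeQCDFlow.Theory2.Tunnelling
open Summit.Ventures.LatticeQCDFlow.Exactness

variable {d L : ℕ}

/-! ## §1. The MD drift and the momentum collar -/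

/-- The MD drift of the links for time `δ` by Lie-algebra momenta `ϖ`: `U_e ↦ exp(i δ ϖ_e) · U_e`.
[folklore] -/
def drift (δ : ℝ) (ϖ : Edge d L → ℝ) (U : GaugeConfig d L Circle) : GaugeConfig d L Circle :=
  fun e => Circle.exp (δ * ϖ e) * U e

/-- The drift acts linkwise. [folklore] -/
@[simp] theorem drift_apply (δ : ℝ) (ϖ : Edge d L → ℝ) (U : GaugeConfig d L Circle) (e : Edge d L) :
    drift δ ϖ U e = Circle.exp (δ * ϖ e) * U e := rfl

/-- A drift by zero momenta (a momentum KICK seen from the configuration) does nothing. [folklore] -/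
@[simp] theorem drift_zero (δ : ℝ) (U : GaugeConfig d L Circle) : drift δ 0 U = U := by
  funext e; simp [drift]

/-- A drift moves each link by the chord `|2 sin(δ ϖ_e/2)| ≤ |δ|·|ϖ_e|`. [folklore] -/
theorem dist_drift_le (δ : ℝ) (ϖ : Edge d L → ℝ) (U : GaugeConfig d L Circle) (e : Edge d L) :
    dist (U e) (drift δ ϖ U e) ≤ |δ| * |ϖ e| := by
  rw [dist_comm, drift_apply, Circle.dist_exp_mul_self, abs_mul, abs_two]
  calc 2 * |Real.sin (δ * ϖ e / 2)| ≤ 2 * |δ * ϖ e / 2| :=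
        mul_le_mul_of_nonneg_left (Real.abs_sin_le_abs) (by norm_num)
    _ = |δ| * |ϖ e| := by rw [abs_div, abs_mul, abs_two]; ring

/-- The lattice CURL of the momenta around the plaquette at `x` in the `(μ,ν)` plane — the angular
velocity of `U_p` under the drift (`plaquetteHolonomy_drift`). [folklore] -/
def plaqCurl (ϖ : Edge d L → ℝ) (x : Site d L) (μ ν : Fin d) : ℝ :=
  ϖ (x, μ) + ϖ (x.shift μ, ν) - ϖ (x.shift ν, μ) - ϖ (x, ν)

/-- **Abelian drift of a plaquette.**  The drift rotates each plaquette rigidly by the angle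
`δ · curl ϖ`. [folklore] -/
theorem plaquetteHolonomy_drift (δ : ℝ) (ϖ : Edge d L → ℝ) (U : GaugeConfig d L Circle) (x : Site d L)
    (μ ν : Fin d) : plaquetteHolonomy (drift δ ϖ U) x μ ν =
      Circle.exp (δ * plaqCurl ϖ x μ ν) * plaquetteHolonomy U x μ ν := by
  simp only [plaquetteHolonomy, drift_apply, plaqCurl, mul_add, mul_sub, Circle.exp_add,
    Circle.exp_sub, mul_inv, div_eq_mul_inv]
  simp only [mul_assoc, mul_comm, mul_left_comm]

/-- The DRIFT MARGIN of the plaquette at `x`: the arc `|δ|·|curl ϖ|` it sweeps during the drift.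
[folklore] -/
def driftMargin (δ : ℝ) (ϖ : Edge d L → ℝ) (x : Site d L) (μ ν : Fin d) : ℝ :=
  |δ| * |plaqCurl ϖ x μ ν|

/-- The drift margin is non-negative. [folklore] -/
theorem driftMargin_nonneg (δ : ℝ) (ϖ : Edge d L → ℝ) (x : Site d L) (μ ν : Fin d) :
    0 ≤ driftMargin δ ϖ x μ ν := by
  unfold driftMargin; positivity

/-- The drift margin is at most `|δ|` times the total momentum on the four links (the bound one gets
from the four-link displacement `plaqDisp_drift_le`; the curl is sharper by signs). [folklore] -/
theorem driftMargin_le_linkSum (δ : ℝ) (ϖ : Edge d L → ℝ) (x : Site d L) (μ ν : Fin d) :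
    driftMargin δ ϖ x μ ν ≤
      |δ| * (|ϖ (x, μ)| + |ϖ (x.shift μ, ν)| + |ϖ (x.shift ν, μ)| + |ϖ (x, ν)|) := by
  unfold driftMargin plaqCurl
  refine mul_le_mul_of_nonneg_left (abs_le.2 ⟨?_, ?_⟩) (abs_nonneg δ)
  · linarith [neg_abs_le (ϖ (x, μ)), neg_abs_le (ϖ (x.shift μ, ν)), le_abs_self (ϖ (x.shift ν, μ)),
      le_abs_self (ϖ (x, ν))]
  · linarith [le_abs_self (ϖ (x, μ)), le_abs_self (ϖ (x.shift μ, ν)), neg_abs_le (ϖ (x.shift ν, μ)),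
      neg_abs_le (ϖ (x, ν))]

/-- The four links of a plaquette move by at most `|δ|` times their total momentum. [folklore] -/
theorem plaqDisp_drift_le (δ : ℝ) (ϖ : Edge d L → ℝ) (U : GaugeConfig d L Circle) (x : Site d L)
    (μ ν : Fin d) : plaqDisp U (drift δ ϖ U) x μ ν ≤
      |δ| * (|ϖ (x, μ)| + |ϖ (x.shift μ, ν)| + |ϖ (x.shift ν, μ)| + |ϖ (x, ν)|) := by
  unfold plaqDisp
  have h1 := dist_drift_le δ ϖ U (x, μ)
  have h2 := dist_drift_le δ ϖ U (x.shift μ, ν)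
  have h3 := dist_drift_le δ ϖ U (x.shift ν, μ)
  have h4 := dist_drift_le δ ϖ U (x, ν)
  nlinarith [abs_nonneg δ]

/-- If a rotation by `s` takes a point `P` of the circle to `-1`, then `P` is within the chord
`|2 sin(s/2)| ≤ |s|` of `-1`. [folklore] -/
theorem norm_coe_add_one_le_of_exp_mul_eq {s : ℝ} {P : Circle} (h : Circle.exp s * P = -1) :
    ‖(P : ℂ) + 1‖ ≤ |s| := by
  have hC : (Circle.exp s : ℂ) * (P : ℂ) = -1 := by
    have := congrArg ((↑) : Circle → ℂ) h
    simpa using this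
  have e : (P : ℂ) + 1 = (1 - (Circle.exp s : ℂ)) * P := by linear_combination hC
  have hd : ‖(Circle.exp s : ℂ) - 1‖ = |2 * Real.sin (s / 2)| := by
    have := Circle.dist_exp_mul_self s 1
    rwa [mul_one, U1.dist_eq_norm_coe, Circle.coe_one] at this
  rw [e, norm_mul, Circle.norm_coe, mul_one, norm_sub_rev, hd, abs_mul, abs_two]
  calc 2 * |Real.sin (s / 2)| ≤ 2 * |s / 2| := mul_le_mul_of_nonneg_left Real.abs_sin_le_abs (by norm_num)
    _ = |s| := by rw [abs_div, abs_two]; ring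

/-- The drift is continuous in MD time. [folklore] -/
theorem continuous_drift_time (δ : ℝ) (ϖ : Edge d L → ℝ) (U : GaugeConfig d L Circle) :
    Continuous fun t : ℝ => drift (t * δ) ϖ U := by
  refine continuous_pi fun e => ?_
  have h1 : Continuous fun t : ℝ => t * δ * ϖ e := (continuous_id.mul continuous_const).mul continuous_const
  exact (Circle.exp.continuous.comp h1).mul continuous_const

/-- Zero MD time: no motion. [folklore] -/
@[simp] theorem drift_zero_time (ϖ : Edge d L → ℝ) (U : GaugeConfig d L Circle) : drift 0 ϖ U = U := by
  funext e; simp [drift]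

variable [NeZero L]

/-- The MOMENTUM COLLAR of the `(μ,ν)`-plane through `x₀` for a drift `(δ, ϖ)`: some plane plaquette
is within its own drift margin `|δ · curl ϖ|` (chordally) of the cut locus `-1`. [folklore] -/
def driftCollar (x₀ : Site d L) (μ ν : Fin d) (δ : ℝ) (ϖ : Edge d L → ℝ) :
    Set (GaugeConfig d L Circle) :=
  {U | ∃ p : ZMod L × ZMod L,
    ‖((plaquetteHolonomy U (planeSite x₀ μ ν p) μ ν : Circle) : ℂ) + 1‖ ≤
      driftMargin δ ϖ (planeSite x₀ μ ν p) μ ν}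

omit [NeZero L] in
/-- The momentum collar lies in the plane collar of any width dominating all drift margins (link to
the sup-metric law of `Scaling/FluxTunnelling.lean`). [folklore] -/
theorem driftCollar_subset_planeCollar (x₀ : Site d L) (μ ν : Fin d) {δ : ℝ} {ϖ : Edge d L → ℝ}
    {s : ℝ} (hs : ∀ p : ZMod L × ZMod L, driftMargin δ ϖ (planeSite x₀ μ ν p) μ ν ≤ s) :
    driftCollar x₀ μ ν δ ϖ ⊆ planeCollar x₀ μ ν s := fun _ ⟨p, hp⟩ => ⟨p, hp.trans (hs p)⟩

/-- **Separating set for one drift (sharp, abelian).**  Along the MD segment `t ↦ drift (tδ) ϖ U`,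
`t ∈ [0,1]`, each plane plaquette rotates rigidly by `tδ·curl ϖ`; if none of them passes through
`-1` the plane charge is constant (plane-local sector confinement,
`topCharge_comp_eq_of_preconnected_plane`); if one does, at time `t`, it started within the chord
`|2 sin(tδ curl/2)| ≤ |δ · curl ϖ|` of `-1`.  Hence a drift that changes the plane charge starts in
the momentum collar. [folklore] -/
theorem mem_driftCollar_of_topCharge_ne (x₀ : Site d L) (μ ν : Fin d) {δ : ℝ} {ϖ : Edge d L → ℝ}
    {U : GaugeConfig d L Circle} (hQ : topCharge x₀ μ ν U ≠ topCharge x₀ μ ν (drift δ ϖ U)) :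
    U ∈ driftCollar x₀ μ ν δ ϖ := by
  by_contra hU
  haveI : PreconnectedSpace (Icc (0 : ℝ) 1) := Subtype.preconnectedSpace isPreconnected_Icc
  have hT : Continuous fun t : Icc (0 : ℝ) 1 => drift ((t : ℝ) * δ) ϖ U :=
    (continuous_drift_time δ ϖ U).comp continuous_subtype_val
  have hD : ∀ (t : Icc (0 : ℝ) 1) (p : ZMod L × ZMod L),
      plaquetteHolonomy (drift ((t : ℝ) * δ) ϖ U) (planeSite x₀ μ ν p) μ ν ≠ -1 := by
    intro t p hp
    rw [plaquetteHolonomy_drift] at hp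
    refine hU ⟨p, (norm_coe_add_one_le_of_exp_mul_eq hp).trans ?_⟩
    rw [driftMargin, abs_mul, abs_mul, mul_assoc]
    refine (mul_le_mul_of_nonneg_right (abs_le.2 ⟨by linarith [t.2.1], t.2.2⟩)
      (by positivity)).trans_eq (one_mul _)
  have h := topCharge_comp_eq_of_preconnected_plane hT x₀ μ ν hD ⟨0, le_rfl, zero_le_one⟩
    ⟨1, zero_le_one, le_rfl⟩
  simp only [zero_mul, one_mul, drift_zero_time] at h
  exact hQ h

/-! ## §2. Trajectories of drifts and kicks -/

/-- **Deterministic trajectory law.**  Phase space `U(1)^E × M` (any momentum type `M`); steps whose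
configuration component is a drift by a momentum field read off the current phase point
(`(step k z).1 = drift (δ k) (g k z) z.1`; kicks: `g k = 0`).  If the plane charge differs between node
`0` and node `n`, some node `k < n` lies in the momentum collar of its own step. [folklore] -/
theorem exists_mem_driftCollar_of_nodes_ne (x₀ : Site d L) (μ ν : Fin d) {M : Type*}
    (step : ℕ → GaugeConfig d L Circle × M → GaugeConfig d L Circle × M) (δ : ℕ → ℝ)
    (g : ℕ → GaugeConfig d L Circle × M → (Edge d L → ℝ))
    (hdrift : ∀ k z, (step k z).1 = drift (δ k) (g k z) z.1) (z : GaugeConfig d L Circle × M) {n : ℕ}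
    (hQ : topCharge x₀ μ ν (MD.nodes step n z).1 ≠ topCharge x₀ μ ν z.1) :
    ∃ k < n, (MD.nodes step k z).1 ∈ driftCollar x₀ μ ν (δ k) (g k (MD.nodes step k z)) := by
  obtain ⟨k, hk, hne⟩ :=
    MD.exists_step_chargeNe_of_nodes_ne step (fun w => topCharge x₀ μ ν w.1) z hQ
  refine ⟨k, hk, mem_driftCollar_of_topCharge_ne x₀ μ ν ?_⟩
  rw [← hdrift]
  exact fun heq => hne heq.symm

/-! ## §3. Measurability of the collar events and the `U(1)` HMC flux tunnelling law -/

/-- The chordal distance of a plaquette to `-1` is a measurable function of the configuration.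
[folklore] -/
theorem measurable_plaquetteCutDist (x : Site d L) (μ ν : Fin d) :
    Measurable fun U : GaugeConfig d L Circle =>
      ‖((plaquetteHolonomy U x μ ν : Circle) : ℂ) + 1‖ :=
  (continuous_norm.comp ((continuous_subtype_val.comp (continuous_plaquetteHolonomy x μ ν)).add
    continuous_const)).measurable

omit [NeZero L] in
/-- The drift margin is a measurable function of the momenta. [folklore] -/
theorem measurable_driftMargin {M : Type*} [MeasurableSpace M] {g : M → (Edge d L → ℝ)}
    (hg : Measurable g) (δ : ℝ) (x : Site d L) (μ ν : Fin d) :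
    Measurable fun m : M => driftMargin δ (g m) x μ ν := by
  unfold driftMargin plaqCurl
  have h : ∀ e : Edge d L, Measurable fun m : M => g m e := fun e =>
    (measurable_pi_apply e).comp hg
  exact ((((h _).add (h _)).sub (h _)).sub (h _)).abs.const_mul _

/-- The momentum-collar event `{z | z.1 ∈ driftCollar (δ) (g z)}` of phase space is measurable for a
measurable momentum field `g`. [folklore] -/
theorem measurableSet_driftCollarAt (x₀ : Site d L) (μ ν : Fin d) {M : Type*} [MeasurableSpace M]
    {g : GaugeConfig d L Circle × M → (Edge d L → ℝ)} (hg : Measurable g) (δ : ℝ) :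
    MeasurableSet {z : GaugeConfig d L Circle × M | z.1 ∈ driftCollar x₀ μ ν δ (g z)} := by
  have e : {z : GaugeConfig d L Circle × M | z.1 ∈ driftCollar x₀ μ ν δ (g z)} =
      ⋃ p : ZMod L × ZMod L, {z | ‖((plaquetteHolonomy z.1 (planeSite x₀ μ ν p) μ ν : Circle) : ℂ) + 1‖ ≤
        driftMargin δ (g z) (planeSite x₀ μ ν p) μ ν} := by
    ext z; simp [driftCollar]
  rw [e]
  exact MeasurableSet.iUnion fun p =>
    measurableSet_le ((measurable_plaquetteCutDist _ μ ν).comp measurable_fst)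
      (measurable_driftMargin hg δ _ μ ν)

/-- **`U(1)` HMC FLUX TUNNELLING LAW.**  Target `e^{-S}volU` for ANY measurable action `S`, momenta on
any measurable space `M` with kinetic term `T`, `0 < Z_T < ∞`, law `Z_T⁻¹e^{-T}volP`; proposal
`Φ = flip ∘ (nodes step n)` with `volU ⊗ volP`-preserving steps whose configuration component is a
drift by a measurable momentum field `g k` (kicks: `g k = 0`), `flip` not touching the configuration;
Metropolis filter `min(1, e^{-ΔH})` — the kernel of `hmc_config_exact`.  Then for every `h : ℝ` the
stationary mass of plane-charge changes per update obeys
`(e^{-S}volU ⊗ K){Q ≠ Q'} ≤ Z_T⁻¹ Σ_{k<n} (e^{h}·B{z | z.1 ∈ driftCollar (δ k) (g k z)} + B{ΔH_k > h})`,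
`B = e^{-(S+T)}(volU ⊗ volP)`, `ΔH_k(z) = H(node k) - H(node 0)`. [folklore] -/
theorem hmc_topCharge_ne_le_sum (x₀ : Site d L) (μ ν : Fin d) {M : Type*} [MeasurableSpace M]
    (volU : Measure (GaugeConfig d L Circle)) (volP : Measure M) [SFinite volU] [SFinite volP]
    {S : GaugeConfig d L Circle → ℝ} (hS : Measurable S) {T : M → ℝ} (hT : Measurable T)
    {step : ℕ → GaugeConfig d L Circle × M → GaugeConfig d L Circle × M}
    (hstep : ∀ k, MeasurePreserving (step k) (volU.prod volP) (volU.prod volP))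
    (δ : ℕ → ℝ) {g : ℕ → GaugeConfig d L Circle × M → (Edge d L → ℝ)} (hg : ∀ k, Measurable (g k))
    (hdrift : ∀ k z, (step k z).1 = drift (δ k) (g k z) z.1)
    {flip : GaugeConfig d L Circle × M → GaugeConfig d L Circle × M} (hflip : ∀ z, (flip z).1 = z.1)
    (n : ℕ) {Φ : GaugeConfig d L Circle × M → GaugeConfig d L Circle × M} (hΦ : Measurable Φ)
    (hΦeq : ∀ z, Φ z = flip (MD.nodes step n z))
    (hZ0 : volP.withDensity (fun π => ENNReal.ofReal (Real.exp (-T π))) Set.univ ≠ 0)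
    (hZtop : volP.withDensity (fun π => ENNReal.ofReal (Real.exp (-T π))) Set.univ ≠ ∞) (h : ℝ) :
    (MD.boltz volU S ⊗ₘ
        refreshUpdate (involMH Φ hΦ fun z : GaugeConfig d L Circle × M => S z.1 + T z.2)
          ((volP.withDensity (fun π => ENNReal.ofReal (Real.exp (-T π))) Set.univ)⁻¹ •
            volP.withDensity fun π => ENNReal.ofReal (Real.exp (-T π))))
      {q | topCharge x₀ μ ν q.1 ≠ topCharge x₀ μ ν q.2} ≤
      (volP.withDensity (fun π => ENNReal.ofReal (Real.exp (-T π))) Set.univ)⁻¹ *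
        ∑ k ∈ Finset.range n,
          (ENNReal.ofReal (Real.exp h) *
              MD.boltz (volU.prod volP) (fun z => S z.1 + T z.2)
                {z | z.1 ∈ driftCollar x₀ μ ν (δ k) (g k z)} +
            MD.boltz (volU.prod volP) (fun z => S z.1 + T z.2)
              {z | h < (S (MD.nodes step k z).1 + T (MD.nodes step k z).2) - (S z.1 + T z.2)}) :=
  MD.hmc_chargeNe_le_sum volU volP hS hT hstep hflip n hΦ hΦeq (measurable_topCharge x₀ μ ν)
    (fun k => {z | z.1 ∈ driftCollar x₀ μ ν (δ k) (g k z)})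
    (fun k => measurableSet_driftCollarAt x₀ μ ν (hg k) (δ k))
    (fun k z hne => mem_driftCollar_of_topCharge_ne x₀ μ ν (by
      rw [← hdrift]; exact fun heq => hne heq.symm))
    hZ0 hZtop h

/-- **Collar mass = momentum-averaged plaquette cut-tails (Tonelli).**  When the driving field is a
function `γ` of the momenta alone (leapfrog: `γ = id` at the drift, `0` at the kicks), the phase-space
Boltzmann weight `e^{-(S+T)}(volU ⊗ volP) = (e^{-S}volU) ⊗ (e^{-T}volP)` of the momentum-collar event
is at most the sum over the `L²` plane plaquettes `p` of the `e^{-T}volP`-average over momenta `π` of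
the `e^{-S}volU`-mass of `{U | ‖U_p + 1‖ ≤ |δ|·|curl π (p)|}` — the plaquette's cut-tail at its own
swept arc (THEORY-2.md §3.3 evaluates this under the `d = 2` Wilson weight). [folklore] -/
theorem boltz_driftCollarAt_le_sum (x₀ : Site d L) (μ ν : Fin d) {M : Type*} [MeasurableSpace M]
    (volU : Measure (GaugeConfig d L Circle)) (volP : Measure M) [SFinite volU] [SFinite volP]
    {S : GaugeConfig d L Circle → ℝ} (hS : Measurable S) {T : M → ℝ} (hT : Measurable T) (δ : ℝ)
    {γ : M → (Edge d L → ℝ)} (hγ : Measurable γ) :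
    MD.boltz (volU.prod volP) (fun z => S z.1 + T z.2) {z | z.1 ∈ driftCollar x₀ μ ν δ (γ z.2)} ≤
      ∑ p : ZMod L × ZMod L, ∫⁻ π, MD.boltz volU S
        {U | ‖((plaquetteHolonomy U (planeSite x₀ μ ν p) μ ν : Circle) : ℂ) + 1‖ ≤
          driftMargin δ (γ π) (planeSite x₀ μ ν p) μ ν} ∂(MD.boltz volP T) := by
  have e : MD.boltz (volU.prod volP) (fun z => S z.1 + T z.2) =
      (MD.boltz volU S).prod (MD.boltz volP T) :=
    withDensity_exp_neg_add_prod volU volP hS hT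
  have hC : {z : GaugeConfig d L Circle × M | z.1 ∈ driftCollar x₀ μ ν δ (γ z.2)} =
      ⋃ p : ZMod L × ZMod L, {z | ‖((plaquetteHolonomy z.1 (planeSite x₀ μ ν p) μ ν : Circle) : ℂ) + 1‖ ≤
        driftMargin δ (γ z.2) (planeSite x₀ μ ν p) μ ν} := by
    ext z; simp [driftCollar]
  rw [e, hC]
  refine (measure_iUnion_fintype_le _ _).trans (le_of_eq (Finset.sum_congr rfl fun p _ => ?_))
  have hmeas : MeasurableSet {z : GaugeConfig d L Circle × M |
      ‖((plaquetteHolonomy z.1 (planeSite x₀ μ ν p) μ ν : Circle) : ℂ) + 1‖ ≤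
        driftMargin δ (γ z.2) (planeSite x₀ μ ν p) μ ν} :=
    measurableSet_le ((measurable_plaquetteCutDist (planeSite x₀ μ ν p) μ ν).comp measurable_fst)
      ((measurable_driftMargin hγ δ (planeSite x₀ μ ν p) μ ν).comp measurable_snd)
  exact (Measure.prod_apply_symm hmeas).trans rfl

end Summit.Ventures.LatticeQCDFlow.Theory2.Lattice.Flux

end
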